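import Summits.Ventures.DiscreteObjects.Hadamard.ConferenceGraph333
import Summits.Ventures.DiscreteObjects.Hadamard.ClassSumTrace

/-!
# Involutions of srg(333,166,82,83) move as many adjacent as non-adjacent pairs: `Σ_x S_{x,τx} = 0` (kernel)

Framing: lottery ticket; floor = certified bounds/negative ranges.  Cell pub-namedobj (venture DiscreteObjects),
target (H) = `H(668)`, hadamard gen 28; a second, sharper route to the involution law of
`ConferenceGraph333Involution` (`f ≡ 1 (mod 4)`), by the 'twisted' trace: for the Seidel matrix `S`
(`S² = 333·I − J`, `S𝟙 = 0`, symmetric) and an adjacency-preserving involution `τ`, the integer matrix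
`M_{x,y} = S_{τx,y}` satisfies `M³ = 333·M` (`S³ = 333·S`, `τ³ = τ`, `τ` commutes with `S`), so `tr M = Σ_x S_{τx,x} = 0`
(`ClassSumTrace.trace_eq_zero_of_mul_mul_eq_smul`, `333` non-square):
* **`involution_twisted_trace_zero`** — `Σ_x S_{x,τx} = 0`;
* **`involution_moved_edges_eq_nonedges`** — among the vertices moved by `τ`, as many are adjacent to their image
  as are not: `#{x : τx ≠ x, x ~ τx} = #{x : τx ≠ x, x ≁ τx}`; hence the number `m` of transpositions of `τ` is even and
  exactly `m/2` of the transposed pairs are edges (**`involution_fixedPoints_mod_four'`**: `f ≡ 1 (mod 4)` again).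
For automorphisms of order `n` with `37 ∤ n` the same identity `Σ_x S_{x,τ^k x} = 0` (all `k`) holds by a Galois
argument (`√37 ∉ ℚ(ζ_{2n})`), forcing an ODD number of fixed points — paper-level for now (see the seat's notes); the
involution case is the one where `M³ = 333M` makes it elementary.  Structure of a hypothetical object.
No `sorry`, no new definitions.
-/

namespace Summit.Ventures.DiscreteObjects.Hadamard

open Finset

section invol
variable {V : Type*} [Fintype V] [DecidableEq V]

/-- `333` is not a square (private copy). -/
private theorem not_isSquare_333_ie : ¬ IsSquare (333 : ℕ) := by
  rintro ⟨r, hr⟩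
  have : r ≤ 19 := by nlinarith
  interval_cases r <;> omega

/-- **Twisted trace.**  For an adjacency-preserving involution `τ` of an `srg(333,166,82,83)`, the Seidel entries
along `τ` sum to zero: `Σ_x S_{x,τx} = 0` where `S_{xy} = 1 − [x=y] − 2A_{xy}`. -/
theorem involution_twisted_trace_zero (hV : Fintype.card V = 333) (A : Matrix V V ℤ)
    (h01 : ∀ x y, A x y = 0 ∨ A x y = 1) (hsymm : ∀ x y, A y x = A x y) (hdiag : ∀ x, A x x = 0)
    (hk : ∀ x, ∑ y, A x y = 166) (hsrg : ∀ x y, ∑ z, A x z * A z y = 83 * (1 + (if x = y then 1 else 0)) - A x y)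
    (τ : Equiv.Perm V) (hτ : ∀ x, τ (τ x) = x) (hA : ∀ x y, A (τ x) (τ y) = A x y) :
    ∑ x, (1 - (if x = τ x then (1 : ℤ) else 0) - 2 * A x (τ x)) = 0 := by
  obtain ⟨hSd, hSo, hSs, hS1, hSS⟩ := seidel_identities_of_conferenceGraph A h01 hsymm hdiag 83
    (by rw [hV]; norm_num) (fun x => by rw [hk x]; norm_num) hsrg
  set S : V → V → ℤ := fun x y => 1 - (if x = y then 1 else 0) - 2 * A x y with hS_def
  have hSS' : ∀ x y, ∑ z, S x z * S z y = 333 * (if x = y then 1 else 0) - 1 := fun x y => by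
    rw [hSS x y, hV]; norm_num
  have hSτ : ∀ x y, S (τ x) (τ y) = S x y := fun x y => by
    simp only [hS_def, hA, τ.injective.eq_iff]
  have hS1' : ∀ x, ∑ y, S x y = 0 := fun x => hS1 x
  have hSs' : ∀ x y, S y x = S x y := fun x y => hSs x y
  have hScol : ∀ y, ∑ x, S x y = 0 := fun y => by
    rw [Finset.sum_congr rfl fun x _ => hSs' y x]; exact hS1' y
  -- the twisted matrix
  set M : Matrix V V ℤ := fun x y => S (τ x) y with hM_def
  have hM2 : ∀ x y, (M * M) x y = 333 * (if τ x = τ y then 1 else 0) - 1 := by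
    intro x y
    rw [Matrix.mul_apply]
    have : ∀ z, M x z * M z y = S (τ x) z * S z (τ y) := by
      intro z; simp only [hM_def]; rw [← hSτ z (τ y), hτ, hSs' z]
      -- S (τ z) y = S z (τ y): from hSτ z (τ y) : S (τ z) (τ (τ y)) = S z (τ y)
    rw [Finset.sum_congr rfl fun z _ => this z, hSS']
  have hM3 : M * M * M = ((333 : ℕ) : ℤ) • M := by
    ext x y
    rw [Matrix.mul_apply, Matrix.smul_apply, smul_eq_mul]
    have e : ∀ w, (M * M) x w * M w y = 333 * (if x = w then S (τ w) y else 0) - S (τ w) y := by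
      intro w
      rw [hM2]
      simp only [hM_def, τ.injective.eq_iff]
      split_ifs <;> ring
    rw [Finset.sum_congr rfl fun w _ => e w, Finset.sum_sub_distrib, ← Finset.mul_sum, Finset.sum_ite_eq,
      if_pos (Finset.mem_univ _), Fintype.sum_equiv τ (fun w => S (τ w) y) (fun w => S w y) (fun _ => rfl), hScol,
      sub_zero]
    simp only [hM_def]
    push_cast
    ring
  have htr := trace_eq_zero_of_mul_mul_eq_smul M 333 not_isSquare_333_ie hM3
  -- tr M = Σ_x S (τ x) x = Σ_x S x (τ x)
  have : M.trace = ∑ x, S x (τ x) := by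
    simp only [Matrix.trace, Matrix.diag, hM_def]
    exact Finset.sum_congr rfl fun x _ => hSs' (τ x) x ▸ (hSs' x (τ x)).symm ▸ rfl
  rw [this] at htr
  simpa [hS_def] using htr

/-- **Moved edges = moved non-edges.**  For an adjacency-preserving involution `τ`, the number of vertices `x` with
`τx ≠ x` adjacent to `τx` equals the number with `τx ≠ x` not adjacent to `τx`; hence `333 − f = 4·(#transposed edges)`. -/
theorem involution_moved_edges_eq_nonedges (hV : Fintype.card V = 333) (A : Matrix V V ℤ)
    (h01 : ∀ x y, A x y = 0 ∨ A x y = 1) (hsymm : ∀ x y, A y x = A x y) (hdiag : ∀ x, A x x = 0)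
    (hk : ∀ x, ∑ y, A x y = 166) (hsrg : ∀ x y, ∑ z, A x z * A z y = 83 * (1 + (if x = y then 1 else 0)) - A x y)
    (τ : Equiv.Perm V) (hτ : ∀ x, τ (τ x) = x) (hA : ∀ x y, A (τ x) (τ y) = A x y) :
    (univ.filter fun x => τ x ≠ x ∧ A x (τ x) = 1).card = (univ.filter fun x => τ x ≠ x ∧ A x (τ x) = 0).card := by
  have h := involution_twisted_trace_zero hV A h01 hsymm hdiag hk hsrg τ hτ hA
  -- each summand: 0 if fixed, -1 if moved & adjacent, +1 if moved & non-adjacent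
  have hterm : ∀ x, (1 - (if x = τ x then (1 : ℤ) else 0) - 2 * A x (τ x)) =
      (if τ x ≠ x ∧ A x (τ x) = 0 then 1 else 0) - (if τ x ≠ x ∧ A x (τ x) = 1 then 1 else 0) := by
    intro x
    by_cases hfx : τ x = x
    · rw [hfx, hdiag]; simp
    · have hne : ¬ x = τ x := fun e => hfx e.symm
      rcases h01 x (τ x) with e | e <;> simp [hne, hfx, e]
  rw [Finset.sum_congr rfl fun x _ => hterm x, Finset.sum_sub_distrib, Finset.sum_boole, Finset.sum_boole] at h
  have h' := sub_eq_zero.mp h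
  exact_mod_cast h'.symm

end invol

end Summit.Ventures.DiscreteObjects.Hadamard
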